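import Mathlib.Analysis.Calculus.ContDiff.Deriv
import Mathlib.MeasureTheory.Integral.IntegralEqImproper
import Mathlib.Analysis.Calculus.BumpFunction.Basic
import HarnessLib

/-!
# Weighted radial integrations by parts for profiles supported in `R > 0` ([Elgindi2021] §7.3,
Proposition 7.7 Step 1)

Topic `Literature/Analysis/FluidPDE`. Proof file (everything proved, no definitions, no named
facts) on the proof path of the named fact
`Literature.Analysis.FluidPDE.Elgindi.ElgindiGhoulMasmoudi2021_stabilityCore`
(`ElgindiStabilityDecomposition.lean`). T. M. Elgindi, Ann. of Math. 194 (2021) =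
arXiv:1904.04795, §7.3 proof of Proposition 7.7, Step 1 (pp. 20–21):

> "We start by multiplying (PolarBSL) by `Ψw²` and integrating … We see:
> `α²|∂_RΨRw|² − (α²/2)(Ψ², ∂_R²(R²w²)) + (α(5+α)/2)(Ψ², ∂_R(Rw²)) + … = (F, Ψw²)`."

The two weighted one-dimensional identities behind this display, for `v ∈ C²(ℝ)` compactly
supported inside `(0, ∞)` and a weight `M` (resp. `N`) of class `C²` (resp. `C¹`) on `(0, ∞)`:
`∫₀^∞(−Mv″)v = ∫₀^∞Mv′² − ½∫₀^∞M″v²` (`integral_Ioi_neg_weight_mul_deriv2_mul`) and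
`∫₀^∞(−Nv′)v = ½∫₀^∞N′v²` (`integral_Ioi_neg_weight_mul_deriv_mul`), from
`∫(F)′ = 0` for compactly supported `C¹` functions (`integral_deriv_eq_zero_of_hasCompactSupport`)
and the smoothness of `M·g` for `g` vanishing near `R ≤ 0` (`contDiff_weight_mul`).
-/

noncomputable section

open MeasureTheory Set Real Filter
open _root_.Topology

namespace Literature.Analysis.FluidPDE

namespace Elgindi

/-! ### Two general tools -/

/-- `∫_ℝ F′ = 0` for `F ∈ C¹(ℝ)` with compact support. [folklore] -/
theorem integral_deriv_eq_zero_of_hasCompactSupport {F : ℝ → ℝ} (hF : ContDiff ℝ 1 F) (hs : HasCompactSupport F) :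
    ∫ x, deriv F x = 0 := by
  have hd : ∀ x, HasDerivAt F (deriv F x) x := fun x => ((hF.differentiable (by simp)) x).hasDerivAt
  have hc : Continuous (deriv F) := hF.continuous_deriv le_rfl
  have hi : Integrable (deriv F) := hc.integrable_of_hasCompactSupport hs.deriv
  have h0 : Tendsto F (cocompact ℝ) (𝓝 0) := hs.is_zero_at_infty
  have key := integral_of_hasDerivAt_of_tendsto hd hi (h0.mono_left atBot_le_cocompact) (h0.mono_left atTop_le_cocompact)
  simpa using key

/-- **A weight smooth on `(0,∞)` times a function vanishing below some `a > 0` is smooth on `ℝ`.** [folklore] -/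
theorem contDiff_weight_mul {M g : ℝ → ℝ} {n : WithTop ℕ∞} (hM : ContDiffOn ℝ n M (Ioi 0)) (hg : ContDiff ℝ n g)
    {a : ℝ} (ha : 0 < a) (hga : ∀ x, x < a → g x = 0) : ContDiff ℝ n fun x => M x * g x := by
  refine contDiff_iff_contDiffAt.2 fun x => ?_
  rcases lt_or_ge x a with hx | hx
  · -- locally zero
    have : (fun x => M x * g x) =ᶠ[𝓝 x] fun _ => 0 :=
      Filter.eventuallyEq_of_mem (Iio_mem_nhds hx) fun y hy => by simp [hga y hy]
    exact (contDiffAt_const.congr_of_eventuallyEq this)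
  · have hx0 : 0 < x := lt_of_lt_of_le ha hx
    exact (hM.contDiffAt (Ioi_mem_nhds hx0)).mul hg.contDiffAt

/-- A compactly supported function with support inside `(0,∞)` vanishes below some `a > 0`. [folklore] -/
theorem exists_pos_forall_lt_eq_zero' {g : ℝ → ℝ} (hs : HasCompactSupport g) (hsub : tsupport g ⊆ Ioi 0) :
    ∃ a : ℝ, 0 < a ∧ ∀ x, x < a → g x = 0 := by
  rcases (tsupport g).eq_empty_or_nonempty with he | hne
  · exact ⟨1, one_pos, fun x _ => image_eq_zero_of_notMem_tsupport (by rw [he]; simp)⟩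
  · obtain ⟨m, hm, hmin⟩ := hs.isCompact.exists_isMinOn hne continuous_id.continuousOn
    exact ⟨m, hsub hm, fun x hx => image_eq_zero_of_notMem_tsupport fun h => absurd (hmin h) (by simpa using hx)⟩

/-! ### The weighted identities -/

/-- **`∫₀^∞(−Nv′)v = ½∫₀^∞N′v²`** for `v ∈ C¹(ℝ)` compactly supported inside `(0,∞)` and
`N ∈ C¹((0,∞))`. [cite: Elgindi2021, §7.3 proof of Proposition 7.7 Step 1 ("(α(5+α)/2)(Ψ², ∂_R(Rw²))") (p. 20 of arXiv:1904.04795)] -/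
theorem integral_Ioi_neg_weight_mul_deriv_mul {N v : ℝ → ℝ} (hN : ContDiffOn ℝ 1 N (Ioi 0)) (hv : ContDiff ℝ 1 v)
    (hs : HasCompactSupport v) (hsub : tsupport v ⊆ Ioi 0) :
    ∫ x in Ioi (0 : ℝ), -(N x * deriv v x) * v x = (1 / 2) * ∫ x in Ioi (0 : ℝ), deriv N x * v x ^ 2 := by
  obtain ⟨a, ha, hva⟩ := exists_pos_forall_lt_eq_zero' hs hsub
  have hdv : Differentiable ℝ v := hv.differentiable (by simp)
  have hvc := hv.continuous
  have hdvc : Continuous (deriv v) := hv.continuous_deriv le_rfl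
  have hdva : ∀ x, x < a → deriv v x = 0 := fun x hx => by
    have : v =ᶠ[𝓝 x] fun _ => 0 := Filter.eventuallyEq_of_mem (Iio_mem_nhds hx) fun y hy => hva y hy
    rw [this.deriv_eq, deriv_const]
  have hNd : ∀ x, 0 < x → HasDerivAt N (deriv N x) x := fun x hx =>
    (hN.differentiableOn (by simp) |>.differentiableAt (Ioi_mem_nhds hx)).hasDerivAt
  have hN0 : ContDiffOn ℝ 0 (deriv N) (Ioi 0) := (hN.deriv_of_isOpen isOpen_Ioi (by simp))
  -- `F = N v²` is `C¹` with compact support, `F' = N' v² + 2 N v v'`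
  have hv2 : ContDiff ℝ 1 fun x => v x ^ 2 := hv.pow 2
  have hv2a : ∀ x, x < a → v x ^ 2 = 0 := fun x hx => by simp [hva x hx]
  have hF : ContDiff ℝ 1 fun x => N x * v x ^ 2 := contDiff_weight_mul hN hv2 ha hv2a
  have hFs : HasCompactSupport fun x => N x * v x ^ 2 := by
    have : (fun x => N x * v x ^ 2) = fun x => (N x * v x) * v x := by funext x; ring
    rw [this]; exact hs.mul_left
  have hF' : ∀ x, deriv (fun x => N x * v x ^ 2) x = deriv N x * v x ^ 2 + 2 * (N x * deriv v x * v x) := by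
    intro x
    rcases lt_or_ge x a with hx | hx
    · have : (fun x => N x * v x ^ 2) =ᶠ[𝓝 x] fun _ => 0 :=
        Filter.eventuallyEq_of_mem (Iio_mem_nhds hx) fun y hy => by simp [hva y hy]
      rw [this.deriv_eq, deriv_const, hva x hx, hdva x hx]; ring
    · have hx0 : 0 < x := lt_of_lt_of_le ha hx
      have e2 : (fun x => v x ^ 2) = fun x => v x * v x := by funext x; ring
      have h2 : HasDerivAt (fun x => v x ^ 2) (2 * v x * deriv v x) x := by
        rw [e2]; exact ((hdv x).hasDerivAt.mul (hdv x).hasDerivAt).congr_deriv (by ring)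
      have hmul : HasDerivAt (fun x => N x * v x ^ 2) (deriv N x * v x ^ 2 + N x * (2 * v x * deriv v x)) x :=
        (hNd x hx0).mul h2
      rw [hmul.deriv]; ring
  have h0 := integral_deriv_eq_zero_of_hasCompactSupport hF hFs
  simp_rw [hF'] at h0
  -- both integrands vanish off `(0,∞)`
  have hz1 : ∀ x, x ∉ Ioi (0 : ℝ) → deriv N x * v x ^ 2 = 0 := fun x hx => by
    rw [hva x (lt_of_le_of_lt (not_lt.1 hx) ha)]; ring
  have hz2 : ∀ x, x ∉ Ioi (0 : ℝ) → -(N x * deriv v x) * v x = 0 := fun x hx => by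
    rw [hva x (lt_of_le_of_lt (not_lt.1 hx) ha)]; ring
  rw [setIntegral_eq_integral_of_forall_compl_eq_zero hz1, setIntegral_eq_integral_of_forall_compl_eq_zero hz2]
  -- integrability (continuous with compact support on `ℝ`: the products vanish below `a`)
  have c1 : Continuous fun x => deriv N x * v x ^ 2 := by
    have hg : ContDiff ℝ 0 fun x => v x ^ 2 := contDiff_zero.2 (show Continuous (fun x => v x ^ 2) from hvc.pow 2)
    exact (contDiff_weight_mul (n := 0) hN0 hg ha hv2a).continuous
  have c2 : Continuous fun x => N x * deriv v x * v x := by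
    have hg : ContDiff ℝ 0 fun x => deriv v x * v x := contDiff_zero.2 (show Continuous (fun x => deriv v x * v x) from hdvc.mul hvc)
    have := (contDiff_weight_mul (n := 0) (hN.of_le (by simp)) hg ha (fun x hx => by simp [hva x hx])).continuous
    exact this.congr fun x => by ring
  have s1 : HasCompactSupport fun x => deriv N x * v x ^ 2 := by
    have : (fun x => deriv N x * v x ^ 2) = fun x => (deriv N x * v x) * v x := by funext x; ring
    rw [this]; exact hs.mul_left
  have s2 : HasCompactSupport fun x => N x * deriv v x * v x := hs.mul_left
  have i1 : Integrable fun x => deriv N x * v x ^ 2 := c1.integrable_of_hasCompactSupport s1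
  have i2 : Integrable fun x => N x * deriv v x * v x := c2.integrable_of_hasCompactSupport s2
  rw [integral_add i1 (i2.const_mul 2), integral_const_mul] at h0
  have e : ∫ x, -(N x * deriv v x) * v x = -∫ x, N x * deriv v x * v x := by
    rw [← integral_neg]; exact integral_congr_ae (ae_of_all _ fun x => by ring)
  rw [e]
  linarith

/-- **`∫₀^∞(−Mv″)v = ∫₀^∞Mv′² − ½∫₀^∞M″v²`** for `v ∈ C²(ℝ)` compactly supported inside `(0,∞)`
and `M ∈ C²((0,∞))`. [cite: Elgindi2021, §7.3 proof of Proposition 7.7 Step 1 ("α²|∂_RΨRw|² − (α²/2)(Ψ², ∂_R²(R²w²))") (p. 20 of arXiv:1904.04795)] -/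
theorem integral_Ioi_neg_weight_mul_deriv2_mul {M v : ℝ → ℝ} (hM : ContDiffOn ℝ 2 M (Ioi 0)) (hv : ContDiff ℝ 2 v)
    (hs : HasCompactSupport v) (hsub : tsupport v ⊆ Ioi 0) :
    ∫ x in Ioi (0 : ℝ), -(M x * deriv (deriv v) x) * v x =
      (∫ x in Ioi (0 : ℝ), M x * deriv v x ^ 2) - (1 / 2) * ∫ x in Ioi (0 : ℝ), deriv (deriv M) x * v x ^ 2 := by
  obtain ⟨a, ha, hva⟩ := exists_pos_forall_lt_eq_zero' hs hsub
  have hv1 : ContDiff ℝ 1 v := hv.of_le (by norm_num)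
  have hdv1 : ContDiff ℝ 1 (deriv v) := by have := hv.iterate_deriv' 1 1; simpa using this
  have hdv : Differentiable ℝ v := hv1.differentiable (by simp)
  have hddv : Differentiable ℝ (deriv v) := hdv1.differentiable (by simp)
  have hvc := hv.continuous
  have hdvc := hdv1.continuous
  have hddvc : Continuous (deriv (deriv v)) := hdv1.continuous_deriv le_rfl
  have hdva : ∀ x, x < a → deriv v x = 0 := fun x hx => by
    have : v =ᶠ[𝓝 x] fun _ => 0 := Filter.eventuallyEq_of_mem (Iio_mem_nhds hx) fun y hy => hva y hy
    rw [this.deriv_eq, deriv_const]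
  have hdvs : HasCompactSupport (deriv v) := hs.deriv
  -- the weight and its derivatives on `(0,∞)`
  have hM1 : ContDiffOn ℝ 1 M (Ioi 0) := hM.of_le (by norm_num)
  have hM' : ContDiffOn ℝ 1 (deriv M) (Ioi 0) := hM.deriv_of_isOpen isOpen_Ioi (by norm_num)
  have hMd : ∀ x, 0 < x → HasDerivAt M (deriv M x) x := fun x hx =>
    (hM1.differentiableOn (by simp) |>.differentiableAt (Ioi_mem_nhds hx)).hasDerivAt
  -- (1) `∫ (M v v')' = 0`: `∫ M' v v' + ∫ M v'² + ∫ M v v'' = 0`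
  have hP : ContDiff ℝ 1 fun x => v x * deriv v x := (hv1.mul hdv1)
  have hPa : ∀ x, x < a → v x * deriv v x = 0 := fun x hx => by simp [hva x hx]
  have hF : ContDiff ℝ 1 fun x => M x * (v x * deriv v x) := contDiff_weight_mul hM1 hP ha hPa
  have hFs : HasCompactSupport fun x => M x * (v x * deriv v x) := by
    have : (fun x => M x * (v x * deriv v x)) = fun x => (M x * deriv v x) * v x := by funext x; ring
    rw [this]; exact hs.mul_left
  have hF' : ∀ x, deriv (fun x => M x * (v x * deriv v x)) x =
      deriv M x * (v x * deriv v x) + M x * deriv v x ^ 2 + M x * deriv (deriv v) x * v x := by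
    intro x
    rcases lt_or_ge x a with hx | hx
    · have : (fun x => M x * (v x * deriv v x)) =ᶠ[𝓝 x] fun _ => 0 :=
        Filter.eventuallyEq_of_mem (Iio_mem_nhds hx) fun y hy => by simp [hva y hy]
      rw [this.deriv_eq, deriv_const, hva x hx, hdva x hx]; ring
    · have hx0 : 0 < x := lt_of_lt_of_le ha hx
      have hmul : HasDerivAt (fun x => M x * (v x * deriv v x))
          (deriv M x * (v x * deriv v x) + M x * (deriv v x * deriv v x + v x * deriv (deriv v) x)) x :=
        (hMd x hx0).mul ((hdv x).hasDerivAt.mul (hddv x).hasDerivAt)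
      rw [hmul.deriv]; ring
  have h1 := integral_deriv_eq_zero_of_hasCompactSupport hF hFs
  simp_rw [hF'] at h1
  -- (2) from the first identity with `N = M'`: `∫ (−M' v') v = ½ ∫ M'' v²` on `(0,∞)`
  have h2 := integral_Ioi_neg_weight_mul_deriv_mul hM' hv1 hs hsub
  -- move `h1` to `(0,∞)` and split
  have cA : Continuous fun x => deriv M x * (v x * deriv v x) :=
    (contDiff_weight_mul (n := 0) (hM'.of_le (by simp)) (hP.of_le (by simp)) ha hPa).continuous
  have cB : Continuous fun x => M x * deriv v x ^ 2 := by
    have hg : ContDiff ℝ 0 fun x => deriv v x ^ 2 := contDiff_zero.2 (show Continuous (fun x => deriv v x ^ 2) from hdvc.pow 2)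
    exact (contDiff_weight_mul (n := 0) (hM.of_le (by simp)) hg ha (fun x hx => by simp [hdva x hx])).continuous
  have cC : Continuous fun x => M x * deriv (deriv v) x * v x := by
    have hg : ContDiff ℝ 0 fun x => deriv (deriv v) x * v x :=
      contDiff_zero.2 (show Continuous (fun x => deriv (deriv v) x * v x) from hddvc.mul hvc)
    have := (contDiff_weight_mul (n := 0) (hM.of_le (by simp)) hg ha (fun x hx => by simp [hva x hx])).continuous
    exact this.congr fun x => by ring
  have sA : HasCompactSupport fun x => deriv M x * (v x * deriv v x) := by
    have : (fun x => deriv M x * (v x * deriv v x)) = fun x => (deriv M x * deriv v x) * v x := by funext x; ring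
    rw [this]; exact hs.mul_left
  have sB : HasCompactSupport fun x => M x * deriv v x ^ 2 := by
    have : (fun x => M x * deriv v x ^ 2) = fun x => (M x * deriv v x) * deriv v x := by funext x; ring
    rw [this]; exact hdvs.mul_left
  have sC : HasCompactSupport fun x => M x * deriv (deriv v) x * v x := hs.mul_left
  have iA : Integrable fun x => deriv M x * (v x * deriv v x) := cA.integrable_of_hasCompactSupport sA
  have iB : Integrable fun x => M x * deriv v x ^ 2 := cB.integrable_of_hasCompactSupport sB
  have iC : Integrable fun x => M x * deriv (deriv v) x * v x := cC.integrable_of_hasCompactSupport sC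
  have iAB : Integrable fun x => deriv M x * (v x * deriv v x) + M x * deriv v x ^ 2 := iA.add iB
  rw [integral_add iAB iC, integral_add iA iB] at h1
  have hzA : ∀ x, x ∉ Ioi (0 : ℝ) → deriv M x * (v x * deriv v x) = 0 := fun x hx => by
    rw [hva x (lt_of_le_of_lt (not_lt.1 hx) ha)]; ring
  have hzB : ∀ x, x ∉ Ioi (0 : ℝ) → M x * deriv v x ^ 2 = 0 := fun x hx => by
    rw [hdva x (lt_of_le_of_lt (not_lt.1 hx) ha)]; ring
  have hzC : ∀ x, x ∉ Ioi (0 : ℝ) → M x * deriv (deriv v) x * v x = 0 := fun x hx => by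
    rw [hva x (lt_of_le_of_lt (not_lt.1 hx) ha)]; ring
  have hzL : ∀ x, x ∉ Ioi (0 : ℝ) → -(M x * deriv (deriv v) x) * v x = 0 := fun x hx => by
    rw [hva x (lt_of_le_of_lt (not_lt.1 hx) ha)]; ring
  rw [← setIntegral_eq_integral_of_forall_compl_eq_zero hzA, ← setIntegral_eq_integral_of_forall_compl_eq_zero hzB,
    ← setIntegral_eq_integral_of_forall_compl_eq_zero hzC] at h1
  rw [setIntegral_eq_integral_of_forall_compl_eq_zero hzL, ← setIntegral_eq_integral_of_forall_compl_eq_zero hzL]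
  have eA : ∫ x in Ioi (0 : ℝ), deriv M x * (v x * deriv v x) = -∫ x in Ioi (0 : ℝ), -(deriv M x * deriv v x) * v x := by
    rw [← integral_neg]; exact integral_congr_ae (ae_of_all _ fun x => by ring)
  have eL : ∫ x in Ioi (0 : ℝ), -(M x * deriv (deriv v) x) * v x = -∫ x in Ioi (0 : ℝ), M x * deriv (deriv v) x * v x := by
    rw [← integral_neg]; exact integral_congr_ae (ae_of_all _ fun x => by ring)
  rw [eA, h2] at h1
  rw [eL]
  linarith

end Elgindi

end Literature.Analysis.FluidPDE
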